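import Mathlib
import Literature.MathematicalPhysics.QuantumLattice.BdGBondHamiltonianFreeEnergyBounds
import Summits.HubbardSuperconductivity.HubbardSuperconductivity.Theorems.BalabanIRBirGappedPhaseReductionFockCoercivity
import Summits.HubbardSuperconductivity.HubbardSuperconductivity.Theorems.BalabanIRBirGappedPhaseReductionRChiralityWall
import HarnessLib

/-!
# Route BalabanIR — crux 4R `BirGappedPhaseReductionR` (item `stmt-HubbardSuperconductivity-14846`),
# line `chirality-sheet-peierls`: the chirality-wall coercivity (stub W) READ ON FOCK SPACE —
# the modulus input of the sheet-Peierls step, unconditionally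

The card integrates the local `d+id / d−id` Ising field `σ` out of the Hubbard phase marginal by a
sheet-Peierls / polymer step whose ONLY analytic input is a modulus bound on the fermionic weight of a
chirality texture relative to the uniform `d+id` reference, "supplied, exactly as crux 3 supplies the
phase-gradient factor, by a static quasi-free inequality … plus trace-Hölder". The static inequality is
`bdgChiralityWallCoercivity` (file `…ChiralityWall`, PROVED for all parameters). This file performs the
"plus trace-Hölder" half verbatim along the pattern of `fockCoercivity_of_birBdGPhaseCoercivity`
(file `…FockCoercivity`, crux 3 read on Fock space): transporting the textured bond data along
`FermionTorus.equivTorusSite` to the Jordan–Wigner site type (hopping `τ = -adjacency`, pairing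
`Δ(σ) = -½ conj D_σ`, so that the Nambu matrix of `bdgBondHamiltonian τ Δ(σ) μ` is `Hb(σ)` reindexed and the
`IsHermitian` provisos of the static statement are DISCHARGED), one gets for the Fock-space BdG Hamiltonians
`H_F(σ)` of the chiral reference with a chirality texture `σ` (`Fr(σ)` = number of frustrated ordered diagonal
bonds, `c_w = m Δ₂²/E_max²` the constant of `bdgChiralityWallCoercivity`, `L ≥ 3`):

1. **wall cost of the quasi-free ground-state energy**: `E₀(H_F(σ)) - E₀(H_F(+)) ≥ (c_w/2) Fr(σ)`;
2. **thermal slice bound**: `Tr e^{-βH_F(σ)} ≤ 4^{L²} e^{-β c_w Fr(σ)/2} Tr e^{-βH_F(+)}` (`β ≥ 0`);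
3. **space-time weight bound** (`M = 2^{k+1}` Trotter slices of width `a ≥ 0`, a chirality texture per slice —
   i.e. a configuration of chirality SHEETS):
   `‖Tr ∏_τ e^{-aH_F(σ_τ)}‖ ≤ 4^{L²} e^{-(a c_w/2) Σ_τ Fr(σ_τ)} Tr e^{-MaH_F(+)}`
   (`norm_trace_prod_gibbs_bdg_le_of_coercive`: Hölder `…TraceHolder` + the BdG free-energy bounds).

Item 3 is the card's `|W(θ≡0,σ)/W(+)| ≤ e^{-a·c_w·#frustrated·#slices}`-type input in the tree's
second-quantised vocabulary (at zero phase texture; the prefactor `4^{L²}` is the usual quasi-free entropy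
allowance of the thermal comparison and is absent at `T = 0`, item 1). No hypothesis, no definition.

References: P. G. de Gennes, *Superconductivity of Metals and Alloys* (1966) Ch. 5; V. Bach, E. H. Lieb,
J. P. Solovej, J. Stat. Phys. 76 (1994) 3; B. Simon, *Trace Ideals* (2005) Thm 2.8 (Hölder);
M. Sigrist, K. Ueda, Rev. Mod. Phys. 63 (1991) 239, §VI.
-/

noncomputable section

namespace Summit.HubbardSuperconductivity.HubbardSuperconductivity.Theorems

open scoped BigOperators Matrix ComplexConjugate
open Literature.MathematicalPhysics.QuantumLattice Literature.Probability.LatticeModels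

/-- **Chirality-wall coercivity read on Fock space** (route BalabanIR, crux 4R, line
`chirality-sheet-peierls`: the modulus input of the sheet-Peierls step, unconditionally — see the module
docstring; registered sub-goal `fockChiralityCoercivity` of item stmt-HubbardSuperconductivity-14846).
[cite: Simon2005TraceIdeals, Theorem 2.8] -/
theorem fockChiralityCoercivity : ∀ (μ Δ₁ Δ₂ : ℝ), μ ∈ Set.Ioo (-4:ℝ) 4 → Δ₁ ≠ 0 → Δ₂ ≠ 0 → ∃ c_w : ℝ, 0 < c_w ∧ ∃ L₀ : ℕ, ∀ (L : ℕ) [NeZero L], L₀ ≤ L → letI : DecidableEq (Literature.MathematicalPhysics.QuantumLattice.FermionTorus 2 L) := LinearOrder.toDecidableEq; letI : DecidableEq (Literature.MathematicalPhysics.QuantumLattice.Orb (Literature.MathematicalPhysics.QuantumLattice.FermionTorus 2 L)) := LinearOrder.toDecidableEq; let nnx : Literature.Probability.LatticeModels.TorusSite 2 L → Literature.Probability.LatticeModels.TorusSite 2 L → Prop := fun x y => y = x + ![1, 0] ∨ y = x + ![-1, 0]; let nny : Literature.Probability.LatticeModels.TorusSite 2 L → Literature.Probability.LatticeModels.TorusSite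 2 L → Prop := fun x y => y = x + ![0, 1] ∨ y = x + ![0, -1]; let dg1 : Literature.Probability.LatticeModels.TorusSite 2 L → Literature.Probability.LatticeModels.TorusSite 2 L → Prop := fun x y => y = x + ![1, 1] ∨ y = x + ![-1, -1]; let dg2 : Literature.Probability.LatticeModels.TorusSite 2 L → Literature.Probability.LatticeModels.TorusSite 2 L → Prop := fun x y => y = x + ![1, -1] ∨ y = x + ![-1, 1]; let D : (Literature.Probability.LatticeModels.TorusSite 2 L → Bool) → Matrix (Literature.Probability.LatticeModels.TorusSite 2 L) (Literature.Probability.LatticeModels.TorusSite 2 L) ℂ := fun σ x y => ((Δ₁ : ℂ) * ((if nnx x y then (1 : ℂ) else 0) - (if nny x y then (1 : ℂ) else 0)) + Complex.I * (Δ₂ : ℂ) * ((if dg1 x y then (1 : ℂ) else 0) - (if dg2 x y then (1 : ℂ) else 0)) * (((if σ x then (1 : ℂ) else -1) + (if σ y then (1 : ℂ) else -1)) / 2)) * (Complex.exp (Complex.I * ((0 : ℝ) : ℂ)) + Complex.exp (Complex.I * ((0 : ℝ) : ℂ))) / 2; let e : Literature.MathematicalPhysics.QuantumLattice.FermionTorus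 2 L ≃ Literature.Probability.LatticeModels.TorusSite 2 L := Literature.MathematicalPhysics.QuantumLattice.FermionTorus.equivTorusSite; let τ : Literature.MathematicalPhysics.QuantumLattice.FermionTorus 2 L → Literature.MathematicalPhysics.QuantumLattice.FermionTorus 2 L → ℂ := fun u v => -(if nnx (e u) (e v) ∨ nny (e u) (e v) then (1 : ℂ) else 0); let Δp : (Literature.Probability.LatticeModels.TorusSite 2 L → Bool) → Literature.MathematicalPhysics.QuantumLattice.FermionTorus 2 L → Literature.MathematicalPhysics.QuantumLattice.FermionTorus 2 L → ℂ := fun σ u v => -(1 / 2 : ℂ) * star (D σ (e u) (e v)); let HF : (Literature.Probability.LatticeModels.TorusSite 2 L → Bool) → Matrix (Finset (Literature.MathematicalPhysics.QuantumLattice.Orb (Literature.MathematicalPhysics.QuantumLattice.FermionTorus 2 L))) (Finset (Literature.MathematicalPhysics.QuantumLattice.Orb (Literature.MathematicalPhysics.QuantumLattice.FermionTorus 2 L))) ℂ := fun σ => Literature.MathematicalPhysics.QuantumLattice.bdgBondHamiltonian τ (Δp σ) μ; let Fr : (Literature.Probability.LatticeModels.TorusSite 2 L → Bool) → ℝ :=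 fun σ => ((((Finset.univ : Finset (Literature.Probability.LatticeModels.TorusSite 2 L × Literature.Probability.LatticeModels.TorusSite 2 L)).filter fun p => (p.2 = p.1 + ![1, 1] ∨ p.2 = p.1 + ![-1, -1] ∨ p.2 = p.1 + ![1, -1] ∨ p.2 = p.1 + ![-1, 1]) ∧ σ p.1 ≠ σ p.2).card : ℕ) : ℝ); (∀ σ : Literature.Probability.LatticeModels.TorusSite 2 L → Bool, c_w / 2 * Fr σ ≤ (HF σ).groundEnergy - (HF (fun _ => true)).groundEnergy) ∧ (∀ σ : Literature.Probability.LatticeModels.TorusSite 2 L → Bool, ∀ β : ℝ, 0 ≤ β → (Matrix.partitionFn β (HF σ)).re ≤ 4 ^ (L ^ 2) * Real.exp (-(β * c_w * Fr σ / 2)) * (Matrix.partitionFn β (HF (fun _ => true))).re) ∧ (∀ (k : ℕ) (a : ℝ), 0 ≤ a → ∀ Ss : Fin (2 ^ (k + 1)) → Literature.Probability.LatticeModels.TorusSite 2 L → Bool, ‖(List.ofFn fun i => NormedSpace.exp (-(a : ℂ) • HF (Ss i))).prod.trace‖ ≤ 4 ^ (L ^ 2) * Real.exp (-(a * c_w /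 2 * ∑ i, Fr (Ss i))) * (Matrix.partitionFn (((2 ^ (k + 1) : ℕ) : ℝ) * a) (HF (fun _ => true))).re) := by
  intro μ Δ₁ Δ₂ hμ hΔ₁ hΔ₂
  obtain ⟨c_w, hc, L₀, hL⟩ := bdgChiralityWallCoercivity μ Δ₁ Δ₂ hμ hΔ₁ hΔ₂
  refine ⟨c_w, hc, L₀, ?_⟩
  intro L _ hLL
  letI : DecidableEq (FermionTorus 2 L) := LinearOrder.toDecidableEq
  letI : DecidableEq (Orb (FermionTorus 2 L)) := LinearOrder.toDecidableEq
  intro nnx nny dg1 dg2 D e τ Δp HF Fr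
  have key := hL L hLL
  -- symmetry of the bond relations and of the gap matrix
  have hnnx : ∀ x y, nnx x y ↔ nnx y x := by
    intro x y
    show (y = x + ![1, 0] ∨ y = x + ![-1, 0]) ↔ (x = y + ![1, 0] ∨ x = y + ![-1, 0])
    rw [torusVec_neg_one_zero]
    exact eq_add_or_eq_add_neg_comm x y _
  have hnny : ∀ x y, nny x y ↔ nny y x := by
    intro x y
    show (y = x + ![0, 1] ∨ y = x + ![0, -1]) ↔ (x = y + ![0, 1] ∨ x = y + ![0, -1])
    rw [torusVec_zero_neg_one]
    exact eq_add_or_eq_add_neg_comm x y _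
  have hdg1 : ∀ x y, dg1 x y ↔ dg1 y x := by
    intro x y
    show (y = x + ![1, 1] ∨ y = x + ![-1, -1]) ↔ (x = y + ![1, 1] ∨ x = y + ![-1, -1])
    rw [torusVec_neg_one_neg_one]
    exact eq_add_or_eq_add_neg_comm x y _
  have hdg2 : ∀ x y, dg2 x y ↔ dg2 y x := by
    intro x y
    show (y = x + ![1, -1] ∨ y = x + ![-1, 1]) ↔ (x = y + ![1, -1] ∨ x = y + ![-1, 1])
    rw [torusVec_neg_one_one]
    exact eq_add_or_eq_add_neg_comm x y _
  have hDsym : ∀ σ x y, D σ x y = D σ y x := by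
    intro σ x y
    show ((Δ₁ : ℂ) * ((if nnx x y then (1 : ℂ) else 0) - (if nny x y then (1 : ℂ) else 0)) +
        Complex.I * (Δ₂ : ℂ) * ((if dg1 x y then (1 : ℂ) else 0) - (if dg2 x y then (1 : ℂ) else 0)) *
          (((if σ x then (1 : ℂ) else -1) + (if σ y then (1 : ℂ) else -1)) / 2)) *
        (Complex.exp (Complex.I * ((0 : ℝ) : ℂ)) + Complex.exp (Complex.I * ((0 : ℝ) : ℂ))) / 2 =
      ((Δ₁ : ℂ) * ((if nnx y x then (1 : ℂ) else 0) - (if nny y x then (1 : ℂ) else 0)) +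
        Complex.I * (Δ₂ : ℂ) * ((if dg1 y x then (1 : ℂ) else 0) - (if dg2 y x then (1 : ℂ) else 0)) *
          (((if σ y then (1 : ℂ) else -1) + (if σ x then (1 : ℂ) else -1)) / 2)) *
        (Complex.exp (Complex.I * ((0 : ℝ) : ℂ)) + Complex.exp (Complex.I * ((0 : ℝ) : ℂ))) / 2
    simp only [hnnx x y, hnny x y, hdg1 x y, hdg2 x y,
      add_comm (if σ x then (1 : ℂ) else -1) (if σ y then (1 : ℂ) else -1)]
  -- the symmetric, real hopping matrix `τ₀ = -adjacency` on `TorusSite 2 L`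
  set τ₀ : TorusSite 2 L → TorusSite 2 L → ℂ := fun x y => -(if nnx x y ∨ nny x y then (1 : ℂ) else 0)
    with hτ₀def
  have hτ₀ : ∀ x y, τ₀ x y = τ₀ y x := by
    intro x y
    simp only [hτ₀def, hnnx x y, hnny x y]
  have hτ₀' : ∀ x y, star (τ₀ x y) = τ₀ y x := by
    intro x y
    rw [← hτ₀ x y]
    show star (-(if nnx x y ∨ nny x y then (1 : ℂ) else 0)) = -(if nnx x y ∨ nny x y then (1 : ℂ) else 0)
    split_ifs <;> simp
  -- the static statement's Hermitian provisos, discharged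
  have hHerm : ∀ σ' : TorusSite 2 L → Bool,
      (Matrix.fromBlocks (fun x y => τ₀ x y - (if x = y then (μ : ℂ) else 0)) (D σ') (D σ')ᴴ
        (-(fun x y => τ₀ x y - (if x = y then (μ : ℂ) else 0)))).IsHermitian :=
    fun σ' => isHermitian_fromBlocks_bdg e τ₀ hτ₀ hτ₀' (D σ') (hDsym σ') μ
  -- the Fock-side hopping is Hermitian
  have hτF : ∀ u v : FermionTorus 2 L, star (τ u v) = τ v u := fun u v => hτ₀' (e u) (e v)
  -- transport of the spectral sums
  have hsum : ∀ σ' : TorusSite 2 L → Bool,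
      ∑ i, |(hHerm σ').eigenvalues i| =
        ∑ j, |(isHermitian_bdgNambuMatrix hτF (Δp σ') μ).eigenvalues j| :=
    fun σ' => sum_comp_eigenvalues_fromBlocks_bdg_eq e τ₀ hτ₀ (D σ') (hDsym σ') μ (hHerm σ')
      (isHermitian_bdgNambuMatrix hτF (Δp σ') μ) (fun x => |x|)
  -- the static chirality-wall coercivity, instantiated, in Nambu terms
  have hcoer : ∀ σ' : TorusSite 2 L → Bool, c_w * Fr σ' ≤
      ∑ j, |(isHermitian_bdgNambuMatrix hτF (Δp (fun _ => true)) μ).eigenvalues j| -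
        ∑ j, |(isHermitian_bdgNambuMatrix hτF (Δp σ') μ).eigenvalues j| := by
    intro σ'
    rw [← hsum σ', ← hsum (fun _ => true)]
    exact key σ' (hHerm σ') (hHerm (fun _ => true))
  have hcard : Fintype.card (FermionTorus 2 L) = L ^ 2 := by
    rw [Fintype.card_lex, Fintype.card_fun, Fintype.card_fin, Fintype.card_fin]
  refine ⟨?_, ?_, ?_⟩
  · -- 1. ground-state energies
    intro σ
    have hσ := hcoer σ
    show c_w / 2 * Fr σ ≤ (bdgBondHamiltonian τ (Δp σ) μ).groundEnergy -
      (bdgBondHamiltonian τ (Δp (fun _ => true)) μ).groundEnergy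
    rw [groundEnergy_bdgBondHamiltonian hτF (Δp σ) μ,
      groundEnergy_bdgBondHamiltonian hτF (Δp (fun _ => true)) μ]
    linarith [hσ]
  · -- 2. thermal slice bound
    intro σ β hβ
    have h := re_partitionFn_bdg_le_of_coercive hτF (Δp σ) (Δp (fun _ => true)) μ (hcoer σ) hβ
    rw [hcard] at h
    exact h
  · -- 3. space-time (sheet) weight bound
    intro k a ha Ss
    have h := norm_trace_prod_gibbs_bdg_le_of_coercive hτF μ k ha (fun i => Δp (Ss i)) (Δp (fun _ => true))
      (fun i => Fr (Ss i)) (fun i => hcoer (Ss i))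
    rw [hcard] at h
    exact h

end Summit.HubbardSuperconductivity.HubbardSuperconductivity.Theorems

end
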